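import Mathlib
import HarnessLib
import Summits.NavierStokesRegularity.NavierStokesRegularity.Theorems.TypeIQuarterGateScarEnvelopeTypeIForcedTsaiAlgMomentsBall
import Summits.NavierStokesRegularity.NavierStokesRegularity.Theorems.TypeIQuarterGateScarEnvelopeTypeIForcedTsaiAlgSound

/-!
# ARM B lane E-exact, Type-I-tail class — RATIONAL ENCLOSURES of the level constants at `τ = 3`
  (`A = arctan(10/3)`, `S = √(1+100/9) = √109/3`, `L = arsinh(10/3)`) and of `π·⟨Q4⟩` (LANEX-ALG v4, `…ForcedTsaiAlgCertX`)

* `arctan_ten_thirds_bounds` — `ALo ≤ arctan(10/3) ≤ AHi` from `arctan(10/3) = π/2 − arctan(3/10)` and the alternating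
  power series of `arctan` at `3/10` (Mathlib `Real.hasSum_arctan`, 8 / 9 terms) with the `π` enclosure of `…AlgSound`;
* `sqrt_bounds_tau3` — `SLo ≤ √(1+(10/3)²) ≤ SHi` by squaring;
* `arsinh_ten_thirds_bounds` — `LLo ≤ arsinh(10/3) ≤ LHi` from `exp(arsinh x) = x + √(1+x²)`, `exp 1` to 9 digits and
  `Real.exp_bound` at `LLo − 1`, `LHi − 1`;
* `Q4.encLo_le`, `Q4.encLoPi_le` — the kernel's lower enclosures are lower bounds of `⟨q⟩` and `π·⟨q⟩`.
Nothing here bears on NS regularity.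
-/

noncomputable section

set_option linter.dupNamespace false

namespace Summit.NavierStokesRegularity.NavierStokesRegularity.Cruxes.ScarEnvelopeTypeI.ForcedTsai

open Real Finset

/-! ## `S = √(1 + (10/3)²)` -/

/-- `SLo ≤ √(1+(10/3)²) ≤ SHi`. -/
theorem sqrt_bounds_tau3 :
    (SLo : ℝ) ≤ Real.sqrt (1 + ((10 / (3 : ℚ) : ℚ) : ℝ) ^ 2) ∧ Real.sqrt (1 + ((10 / (3 : ℚ) : ℚ) : ℝ) ^ 2) ≤ (SHi : ℝ) := by
  have hx : ((10 / (3 : ℚ) : ℚ) : ℝ) = 10 / 3 := by push_cast; ring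
  rw [hx]
  constructor
  · refine (Real.le_sqrt (by norm_num [SLo]) (by positivity)).mpr ?_
    norm_num [SLo]
  · rw [show (SHi : ℝ) = Real.sqrt ((SHi : ℝ) ^ 2) by rw [Real.sqrt_sq (by norm_num [SHi])]]
    exact Real.sqrt_le_sqrt (by norm_num [SHi])

/-! ## `A = arctan(10/3)` -/

/-- Terms of the arctan series at `3/10`: `f i = (3/10)^{2i+1}/(2i+1)`. -/
def atanTerm (i : ℕ) : ℝ := (3 / 10 : ℝ) ^ (2 * i + 1) / (2 * (i : ℝ) + 1)

/-- The terms decrease. -/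
theorem antitone_atanTerm : Antitone atanTerm := by
  refine antitone_nat_of_succ_le fun n => ?_
  unfold atanTerm
  have h1 : (3 / 10 : ℝ) ^ (2 * (n + 1) + 1) ≤ (3 / 10 : ℝ) ^ (2 * n + 1) :=
    pow_le_pow_of_le_one (by norm_num) (by norm_num) (by omega)
  have h2 : (0 : ℝ) < 2 * (n : ℝ) + 1 := by positivity
  have h3 : 2 * (n : ℝ) + 1 ≤ 2 * ((n + 1 : ℕ) : ℝ) + 1 := by push_cast; linarith
  have h0 : (0 : ℝ) ≤ (3 / 10 : ℝ) ^ (2 * (n + 1) + 1) := by positivity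
  calc (3 / 10 : ℝ) ^ (2 * (n + 1) + 1) / (2 * ((n + 1 : ℕ) : ℝ) + 1)
      ≤ (3 / 10 : ℝ) ^ (2 * (n + 1) + 1) / (2 * (n : ℝ) + 1) := div_le_div_of_nonneg_left h0 h2 h3
    _ ≤ (3 / 10 : ℝ) ^ (2 * n + 1) / (2 * (n : ℝ) + 1) := div_le_div_of_nonneg_right h1 h2.le

/-- Partial sums of the alternating series converge to `arctan(3/10)`. -/
theorem tendsto_atan_partial :
    Filter.Tendsto (fun n => ∑ i ∈ range n, (-1) ^ i * atanTerm i) Filter.atTop (nhds (Real.arctan (3 / 10))) := by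
  have h := (Real.hasSum_arctan (x := 3 / 10) (by rw [Real.norm_eq_abs, abs_of_pos (by norm_num)]; norm_num)).tendsto_sum_nat
  refine h.congr fun n => Finset.sum_congr rfl fun i _ => ?_
  unfold atanTerm; push_cast; ring

/-- `arctan(3/10)` between 8 and 9 terms of its alternating series. -/
theorem arctan_three_tenths_bounds :
    ∑ i ∈ range 8, (-1) ^ i * atanTerm i ≤ Real.arctan (3 / 10) ∧
      Real.arctan (3 / 10) ≤ ∑ i ∈ range 9, (-1) ^ i * atanTerm i :=
  ⟨antitone_atanTerm.alternating_series_le_tendsto tendsto_atan_partial 4,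
    antitone_atanTerm.tendsto_le_alternating_series tendsto_atan_partial 4⟩

/-- `ALo ≤ arctan(10/3) ≤ AHi`. -/
theorem arctan_ten_thirds_bounds :
    (ALo : ℝ) ≤ Real.arctan (((10 / (3 : ℚ) : ℚ) : ℝ)) ∧ Real.arctan (((10 / (3 : ℚ) : ℚ) : ℝ)) ≤ (AHi : ℝ) := by
  have hx : ((10 / (3 : ℚ) : ℚ) : ℝ) = (3 / 10 : ℝ)⁻¹ := by push_cast; norm_num
  rw [hx, Real.arctan_inv_of_pos (by norm_num)]
  obtain ⟨hlo, hhi⟩ := arctan_three_tenths_bounds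
  obtain ⟨hpl, hph⟩ := pi_mem_enclosure
  simp only [Finset.sum_range_succ, Finset.sum_range_zero, atanTerm] at hlo hhi
  norm_num at hlo hhi
  norm_num [ALo, AHi, piLo, piHi] at hpl hph ⊢
  constructor <;> linarith

/-! ## `L = arsinh(10/3)` -/

/-- `exp 1 · exp y` bounds for `0 ≤ y ≤ 1` from `Real.exp_bound` (14 terms) and `exp 1` to 9 digits. -/
theorem exp_one_add_bounds {y : ℝ} (h0 : 0 ≤ y) (h1 : y ≤ 1) :
    2.7182818283 * (∑ m ∈ range 14, y ^ m / (m.factorial : ℝ) - y ^ 14 * (15 / ((14 : ℕ).factorial * 14))) ≤ Real.exp (1 + y) ∧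
      Real.exp (1 + y) ≤ 2.7182818286 * (∑ m ∈ range 14, y ^ m / (m.factorial : ℝ) + y ^ 14 * (15 / ((14 : ℕ).factorial * 14))) := by
  have hb := Real.exp_bound (x := y) (by rw [abs_of_nonneg h0]; exact h1) (n := 14) (by norm_num)
  rw [abs_of_nonneg h0] at hb
  have hb' : |Real.exp y - ∑ m ∈ range 14, y ^ m / (m.factorial : ℝ)| ≤ y ^ 14 * (15 / ((14 : ℕ).factorial * 14)) := by
    simpa using hb
  obtain ⟨hl, hu⟩ := abs_sub_le_iff.mp hb'
  have he1 := Real.exp_one_gt_d9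
  have he2 := Real.exp_one_lt_d9
  have hey : 0 < Real.exp y := Real.exp_pos y
  rw [Real.exp_add]
  constructor
  · have : ∑ m ∈ range 14, y ^ m / (m.factorial : ℝ) - y ^ 14 * (15 / ((14 : ℕ).factorial * 14)) ≤ Real.exp y := by linarith
    calc (2.7182818283 : ℝ) * (∑ m ∈ range 14, y ^ m / (m.factorial : ℝ) - y ^ 14 * (15 / ((14 : ℕ).factorial * 14)))
        ≤ 2.7182818283 * Real.exp y := by
          rcases le_or_gt 0 (∑ m ∈ range 14, y ^ m / (m.factorial : ℝ) - y ^ 14 * (15 / ((14 : ℕ).factorial * 14))) with hs | hs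
          · exact mul_le_mul_of_nonneg_left this (by norm_num)
          · exact le_trans (mul_nonpos_of_nonneg_of_nonpos (by norm_num) hs.le) (by positivity)
      _ ≤ Real.exp 1 * Real.exp y := mul_le_mul_of_nonneg_right he1.le hey.le
  · have : Real.exp y ≤ ∑ m ∈ range 14, y ^ m / (m.factorial : ℝ) + y ^ 14 * (15 / ((14 : ℕ).factorial * 14)) := by linarith
    calc Real.exp 1 * Real.exp y ≤ 2.7182818286 * Real.exp y := mul_le_mul_of_nonneg_right he2.le hey.le
      _ ≤ 2.7182818286 * (∑ m ∈ range 14, y ^ m / (m.factorial : ℝ) + y ^ 14 * (15 / ((14 : ℕ).factorial * 14))) :=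
          mul_le_mul_of_nonneg_left this (by norm_num)

/-- `LLo ≤ arsinh(10/3) ≤ LHi`. -/
theorem arsinh_ten_thirds_bounds :
    (LLo : ℝ) ≤ Real.arsinh (((10 / (3 : ℚ) : ℚ) : ℝ)) ∧ Real.arsinh (((10 / (3 : ℚ) : ℚ) : ℝ)) ≤ (LHi : ℝ) := by
  have hx : ((10 / (3 : ℚ) : ℚ) : ℝ) = 10 / 3 := by push_cast; ring
  obtain ⟨hSlo, hShi⟩ := sqrt_bounds_tau3
  rw [hx] at hSlo hShi ⊢
  have hE := Real.exp_arsinh (10 / 3 : ℝ)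
  constructor
  · -- exp LLo ≤ 10/3 + √(1+(10/3)²)
    rw [← Real.exp_le_exp, hE]
    obtain ⟨-, hu⟩ := exp_one_add_bounds (y := (LLo : ℝ) - 1) (by norm_num [LLo]) (by norm_num [LLo])
    rw [add_sub_cancel] at hu
    refine hu.trans ?_
    simp only [Finset.sum_range_succ, Finset.sum_range_zero, Nat.factorial]
    norm_num [LLo, SLo] at hSlo ⊢
    linarith
  · rw [← Real.exp_le_exp, hE]
    obtain ⟨hl, -⟩ := exp_one_add_bounds (y := (LHi : ℝ) - 1) (by norm_num [LHi]) (by norm_num [LHi])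
    rw [add_sub_cancel] at hl
    refine le_trans ?_ hl
    simp only [Finset.sum_range_succ, Finset.sum_range_zero, Nat.factorial]
    norm_num [LHi, SHi] at hShi ⊢
    linarith

/-! ## The kernel's lower enclosures are lower bounds -/

namespace Q4

/-- `encLo q ≤ ⟨q⟩` at `x = 10/3`. -/
theorem encLo_le (q : Q4) : (q.encLo : ℝ) ≤ Q4.eval (((10 / (3 : ℚ) : ℚ) : ℝ)) q := by
  obtain ⟨hAl, hAh⟩ := arctan_ten_thirds_bounds
  obtain ⟨hSl, hSh⟩ := sqrt_bounds_tau3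
  obtain ⟨hLl, hLh⟩ := arsinh_ten_thirds_bounds
  have h1 : ((if 0 ≤ q.c1 then q.c1 * ALo else q.c1 * AHi : ℚ) : ℝ) ≤
      (q.c1 : ℝ) * Real.arctan (((10 / (3 : ℚ) : ℚ) : ℝ)) := by
    split_ifs with h
    · rw [Rat.cast_mul]; exact mul_le_mul_of_nonneg_left hAl (by exact_mod_cast h)
    · rw [Rat.cast_mul]
      exact mul_le_mul_of_nonpos_left hAh (by exact_mod_cast (not_le.mp h).le)
  have h2 : ((if 0 ≤ q.c2 then q.c2 * SLo else q.c2 * SHi : ℚ) : ℝ) ≤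
      (q.c2 : ℝ) * Real.sqrt (1 + ((10 / (3 : ℚ) : ℚ) : ℝ) ^ 2) := by
    split_ifs with h
    · rw [Rat.cast_mul]; exact mul_le_mul_of_nonneg_left hSl (by exact_mod_cast h)
    · rw [Rat.cast_mul]
      exact mul_le_mul_of_nonpos_left hSh (by exact_mod_cast (not_le.mp h).le)
  have h3 : ((if 0 ≤ q.c3 then q.c3 * LLo else q.c3 * LHi : ℚ) : ℝ) ≤
      (q.c3 : ℝ) * Real.arsinh (((10 / (3 : ℚ) : ℚ) : ℝ)) := by
    split_ifs with h
    · rw [Rat.cast_mul]; exact mul_le_mul_of_nonneg_left hLl (by exact_mod_cast h)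
    · rw [Rat.cast_mul]
      exact mul_le_mul_of_nonpos_left hLh (by exact_mod_cast (not_le.mp h).le)
  unfold Q4.encLo Q4.eval
  simp only [Rat.cast_add]
  linarith

/-- `encLoPi q ≤ π·⟨q⟩` at `x = 10/3`. -/
theorem encLoPi_le (q : Q4) : (q.encLoPi : ℝ) ≤ π * Q4.eval (((10 / (3 : ℚ) : ℚ) : ℝ)) q := by
  have h := encLo_le q
  obtain ⟨hpl, hph⟩ := pi_mem_enclosure
  unfold Q4.encLoPi
  split_ifs with hs
  · rw [Rat.cast_mul]
    have hs' : (0 : ℝ) ≤ q.encLo := by exact_mod_cast hs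
    calc (q.encLo : ℝ) * (piLo : ℝ) ≤ (q.encLo : ℝ) * π := mul_le_mul_of_nonneg_left hpl hs'
      _ ≤ Q4.eval (((10 / (3 : ℚ) : ℚ) : ℝ)) q * π := mul_le_mul_of_nonneg_right h Real.pi_pos.le
      _ = π * Q4.eval (((10 / (3 : ℚ) : ℚ) : ℝ)) q := mul_comm _ _
  · rw [Rat.cast_mul]
    have hs' : (q.encLo : ℝ) < 0 := by exact_mod_cast (not_le.mp hs)
    calc (q.encLo : ℝ) * (piHi : ℝ) ≤ (q.encLo : ℝ) * π := mul_le_mul_of_nonpos_left hph hs'.le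
      _ ≤ Q4.eval (((10 / (3 : ℚ) : ℚ) : ℝ)) q * π := mul_le_mul_of_nonneg_right h Real.pi_pos.le
      _ = π * Q4.eval (((10 / (3 : ℚ) : ℚ) : ℝ)) q := mul_comm _ _

end Q4

end Summit.NavierStokesRegularity.NavierStokesRegularity.Cruxes.ScarEnvelopeTypeI.ForcedTsai

end
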